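import Literature.NumberTheory.EllipticCurves.Szpiro
import Literature.NumberTheory.DiophantineGeometry.ValuationProductElliptic
import HarnessLib

/-!
# Szpiro's conjecture bounds the valuation product when the multiplicative primes are few (proofs)

Topic `NumberTheory/EllipticCurves`; namespace `Literature.NumberTheory.EllipticCurves`. A proofs
file (theorems only, no definitions), companion of `Szpiro` (`SzpiroConjecture`, abc.S09) and of
`Literature.NumberTheory.DiophantineGeometry.ValuationProductElliptic`
(`multiplicativeValuationProduct W = ∏_{p ∥ N} v_p(Δ_min)`, Pasten's `∏_{p ∣ N_E^*} v_p(Δ_E)`).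

* `multiplicativeValuationProduct_le_of_szpiro` — under `SzpiroConjecture`, for every `k` and
  `ε > 0` there is `C` with `∏_{p ∥ N} v_p(Δ_min) ≤ C · N^ε` for every elliptic `E/ℚ` having at most
  `k` multiplicative primes. Proof: Szpiro at exponent `7` gives `2^{v_p(Δ_min)} ≤ |Δ_min| ≤ C₁ N⁷`,
  so `v_p(Δ_min) · log 2 ≤ log C₁ + 7 log N ≤ log C₁ + 7 (k+1)/ε · N^{ε/(k+1)}` (`log x ≤ x^δ/δ`), and the
  product has `≤ k` factors, each `≤ K N^{ε/(k+1)}` with `K ≥ 1`.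
* `multiplicativeValuationProduct_le_of_szpiro_all` — the same with NO bound on the number of
  multiplicative primes (and no semistability): `∏_{p ∥ N} v_p(Δ_min) ≤ K_ε N^ε` for every elliptic
  `E/ℚ`, by the de Weger/Hindry-type bookkeeping `x ≤ p^{δx}/(δ log p)`, `δ = ε/7`: the product is
  `≤ |Δ_min|^δ · ∏_{p ∥ N} (δ log p)⁻¹` and only the primes `p ≤ e^{1/δ}` contribute factors `> 1`.
  So the many-prime crux `ManyPrimeValuationProduct` and Pasten's Conjecture 1.14 shape for this
  product are consequences of Szpiro as well (added by the same seat, 2026-08-15).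
* `fewPrime_multiplicativeValuationProduct_le_of_szpiro` — the shape of the crux
  `FewPrimeValuationProduct` of route ABC/RibetTakahashiSplit (stmt-ABC-1563: `≤ 3` ODD
  multiplicative primes, hence `≤ 4` in all), WITHOUT its hypothesis "semistable away from `2`":
  so that crux is a consequence of Szpiro's conjecture and its semistability hypothesis is not
  load-bearing (cdisprove seat of stmt-ABC-1563, 2026-08-15).

Informal status: folklore (the remark that Szpiro/abc controls `∏ v_p` is implicit in
[PastenShimura2024] §1, where Conjecture 1.14 is presented as a consequence-strength statement
"not a mild conjecture: it implies `log Δ ≪ N^ε`").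

## References

* [PastenShimura2024] H. Pasten, *Shimura curves and the abc conjecture*, J. Number Theory 254
  (2024), §1 (Thm 1.12, Conj. 1.14).
* [SilvermanAEC2009] J. H. Silverman, *The Arithmetic of Elliptic Curves*, Conj. VIII.11.1 (Szpiro).
-/

noncomputable section

namespace Literature.NumberTheory.EllipticCurves

open Literature.NumberTheory.DiophantineGeometry WeierstrassCurve

/-- **Szpiro ⟹ `∏_{p ∥ N} v_p(Δ_min) ≤ C_{ε,k} N^ε` when there are at most `k` multiplicative primes.**
Each factor satisfies `2^{v_p} ≤ |Δ_min| ≤ C₁ N⁷`, so `v_p ≤ K · N^{ε/(k+1)}` with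
`K = 1 + log C₁ / log 2 + 7(k+1)/(ε log 2) ≥ 1`, and `(K N^{ε/(k+1)})^{card} ≤ K^{k+1} N^ε`. [folklore] -/
theorem multiplicativeValuationProduct_le_of_szpiro (hS : SzpiroConjecture) (k : ℕ) {ε : ℝ}
    (hε : 0 < ε) :
    ∃ C : ℝ, ∀ (W : WeierstrassCurve ℚ) [W.IsElliptic],
      ((W.conductorNorm ℤ).primeFactors.filter (fun p => ¬ p ^ 2 ∣ W.conductorNorm ℤ)).card ≤ k →
      (multiplicativeValuationProduct W : ℝ) ≤ C * (W.conductorNorm ℤ : ℝ) ^ ε := by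
  obtain ⟨C₁, hC₁⟩ := hS 1 one_pos
  set C := max C₁ 1 with hCdef
  have hC1 : 1 ≤ C := le_max_right _ _
  have hC0 : 0 < C := one_pos.trans_le hC1
  set δ := ε / (k + 1) with hδ
  have hk0 : (0 : ℝ) < k + 1 := by positivity
  have hδ0 : 0 < δ := by positivity
  have hlog2 : 0 < Real.log 2 := Real.log_pos one_lt_two
  set K : ℝ := 1 + Real.log C / Real.log 2 + 7 / (δ * Real.log 2) with hK
  have ha : 0 ≤ Real.log C / Real.log 2 := div_nonneg (Real.log_nonneg hC1) hlog2.le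
  have hb : 0 ≤ 7 / (δ * Real.log 2) := by positivity
  have hK1 : 1 ≤ K := by linarith
  refine ⟨K ^ (k + 1), fun W _ hcard => ?_⟩
  set N := W.conductorNorm ℤ with hN
  set Δ := W.minimalDiscriminantNorm ℤ with hΔ
  have hNpos : 0 < N := conductorNorm_pos_holds W
  have hN1 : (1 : ℝ) ≤ N := by exact_mod_cast hNpos
  have hN0 : (0 : ℝ) < N := by linarith
  have hSz : (Δ : ℝ) ≤ C * (N : ℝ) ^ (7 : ℝ) := by
    calc (Δ : ℝ) ≤ C₁ * (N : ℝ) ^ ((6 : ℝ) + 1) := hC₁ W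
      _ = C₁ * (N : ℝ) ^ (7 : ℝ) := by norm_num
      _ ≤ C * (N : ℝ) ^ (7 : ℝ) := mul_le_mul_of_nonneg_right (le_max_left _ _) (by positivity)
  have hNδ : 1 ≤ (N : ℝ) ^ δ := Real.one_le_rpow hN1 hδ0.le
  -- each factor of the product is `≤ K N^δ`
  have hfac : ∀ p ∈ N.primeFactors, ((Δ.factorization p : ℕ) : ℝ) ≤ K * (N : ℝ) ^ δ := by
    intro p hp
    have hp2 : 2 ≤ p := (Nat.prime_of_mem_primeFactors hp).two_le
    by_cases hΔ0 : Δ = 0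
    · rw [hΔ0, Nat.factorization_zero, Finsupp.zero_apply, Nat.cast_zero]; positivity
    have h1 : (2 : ℝ) ^ (Δ.factorization p) ≤ Δ := by
      exact_mod_cast le_trans (Nat.pow_le_pow_left hp2 _) (Nat.ordProj_le p hΔ0)
    have h2 : (Δ.factorization p : ℝ) * Real.log 2 ≤ Real.log C + 7 * Real.log N := by
      have := Real.log_le_log (by positivity) (h1.trans hSz)
      rw [Real.log_pow, Real.log_mul hC0.ne' (by positivity), Real.log_rpow hN0] at this
      linarith
    have h3 : Real.log N ≤ (N : ℝ) ^ δ / δ := Real.log_le_rpow_div hN0.le hδ0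
    have h4 : (Δ.factorization p : ℝ) ≤ (Real.log C + 7 * ((N : ℝ) ^ δ / δ)) / Real.log 2 := by
      rw [le_div_iff₀ hlog2]; linarith
    calc (Δ.factorization p : ℝ) ≤ (Real.log C + 7 * ((N : ℝ) ^ δ / δ)) / Real.log 2 := h4
      _ = Real.log C / Real.log 2 + 7 / (δ * Real.log 2) * (N : ℝ) ^ δ := by
          field_simp
      _ ≤ Real.log C / Real.log 2 * (N : ℝ) ^ δ + 7 / (δ * Real.log 2) * (N : ℝ) ^ δ
            + 1 * (N : ℝ) ^ δ := by
          nlinarith [le_mul_of_one_le_right ha hNδ]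
      _ = K * (N : ℝ) ^ δ := by rw [hK]; ring
  set S := N.primeFactors.filter (fun p => ¬ p ^ 2 ∣ N) with hS
  have hT : (multiplicativeValuationProduct W : ℝ) = ∏ p ∈ S, ((Δ.factorization p : ℕ) : ℝ) := by
    rw [multiplicativeValuationProduct_def, Nat.cast_prod]
  have hKN : 1 ≤ K * (N : ℝ) ^ δ := one_le_mul_of_one_le_of_one_le hK1 hNδ
  rw [hT]
  calc ∏ p ∈ S, ((Δ.factorization p : ℕ) : ℝ) ≤ ∏ _p ∈ S, K * (N : ℝ) ^ δ :=
        Finset.prod_le_prod (fun _ _ => Nat.cast_nonneg _)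
          (fun p hp => hfac p (Finset.mem_filter.mp hp).1)
    _ = (K * (N : ℝ) ^ δ) ^ S.card := Finset.prod_const _
    _ ≤ (K * (N : ℝ) ^ δ) ^ (k + 1) := pow_le_pow_right₀ hKN (hcard.trans (Nat.le_succ k))
    _ = K ^ (k + 1) * (N : ℝ) ^ ε := by
        rw [mul_pow, ← Real.rpow_natCast ((N : ℝ) ^ δ) (k + 1), ← Real.rpow_mul hN0.le, hδ]
        congr 2
        push_cast
        field_simp

/-- **Szpiro ⟹ the few-prime valuation-product bound** (shape of the crux
`FewPrimeValuationProduct`, route ABC/RibetTakahashiSplit, stmt-ABC-1563) WITHOUT its semistability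
hypothesis: `≤ 3` odd multiplicative primes (hence `≤ 4` multiplicative primes in all) give
`∏_{p ∥ N} v_p(Δ_min) ≤ C_ε N^ε`. So refuting that crux refutes Szpiro's conjecture, and its
hypothesis "`p² ∤ N` for odd `p`" is not load-bearing. [folklore] -/
theorem fewPrime_multiplicativeValuationProduct_le_of_szpiro (hS : SzpiroConjecture) {ε : ℝ}
    (hε : 0 < ε) :
    ∃ C : ℝ, ∀ (W : WeierstrassCurve ℚ) [W.IsElliptic],
      ((W.conductorNorm ℤ).primeFactors.filter
          (fun p => p ≠ 2 ∧ ¬ p ^ 2 ∣ W.conductorNorm ℤ)).card ≤ 3 →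
      (multiplicativeValuationProduct W : ℝ) ≤ C * (W.conductorNorm ℤ : ℝ) ^ ε := by
  obtain ⟨C, hC⟩ := multiplicativeValuationProduct_le_of_szpiro hS 4 hε
  refine ⟨C, fun W _ hcard => hC W ?_⟩
  set N := W.conductorNorm ℤ
  have hsub : N.primeFactors.filter (fun p => ¬ p ^ 2 ∣ N) ⊆
      insert 2 (N.primeFactors.filter (fun p => p ≠ 2 ∧ ¬ p ^ 2 ∣ N)) := by
    intro p hp
    rw [Finset.mem_insert, Finset.mem_filter]
    rw [Finset.mem_filter] at hp
    by_cases h2 : p = 2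
    · exact Or.inl h2
    · exact Or.inr ⟨hp.1, h2, hp.2⟩
  calc (N.primeFactors.filter (fun p => ¬ p ^ 2 ∣ N)).card ≤ _ := Finset.card_le_card hsub
    _ ≤ (N.primeFactors.filter (fun p => p ≠ 2 ∧ ¬ p ^ 2 ∣ N)).card + 1 :=
        Finset.card_insert_le _ _
    _ ≤ 4 := by omega

/-! ## No bound on the number of primes -/

/-- `x ≤ p^{δx} / (δ log p)` for real `x`, `p ≥ 2`, `δ > 0` (from `u ≤ eᵘ` with `u = δ x log p`). [folklore] -/
private theorem le_rpow_div {x p δ : ℝ} (hp : 2 ≤ p) (hδ : 0 < δ) :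
    x ≤ p ^ (δ * x) / (δ * Real.log p) := by
  have hp0 : 0 < p := by linarith
  have hlogp : 0 < Real.log p := Real.log_pos (by linarith)
  have hden : 0 < δ * Real.log p := mul_pos hδ hlogp
  rw [le_div_iff₀ hden]
  have h1 : δ * x * Real.log p ≤ Real.exp (δ * x * Real.log p) := by
    linarith [Real.add_one_le_exp (δ * x * Real.log p)]
  calc x * (δ * Real.log p) = δ * x * Real.log p := by ring
    _ ≤ Real.exp (δ * x * Real.log p) := h1
    _ = p ^ (δ * x) := by rw [Real.rpow_def_of_pos hp0]; ring_nf

/-- **Szpiro ⟹ `∏_{p ∥ N} v_p(Δ_min) ≤ K_ε N^ε` for EVERY elliptic curve over `ℚ`** (no bound on the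
number of primes, no semistability): the de Weger/Hindry-type bookkeeping. With `δ = ε/7` and
`x_p = v_p(Δ_min)`: `x_p ≤ p^{δ x_p}/(δ log p)`, so
`T ≤ (∏_{p ∥ N} p^{x_p})^δ · ∏_{p ∥ N} (δ log p)⁻¹ ≤ |Δ_min|^δ · B^{M+1}` where `B = max 1 (δ log 2)⁻¹`
and only the `≤ M + 1` primes `p ≤ M = ⌈e^{1/δ}⌉` have a factor `> 1`; finally `|Δ_min| ≤ C N⁷`.
Hence, under Szpiro, BOTH cruxes `ManyPrimeValuationProduct` / `FewPrimeValuationProduct` of route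
ABC/RibetTakahashiSplit and their union hold (refuting any of them refutes Szpiro; neither the prime
count nor semistability away from `2` is load-bearing at truth level). [folklore] -/
theorem multiplicativeValuationProduct_le_of_szpiro_all (hS : SzpiroConjecture) {ε : ℝ} (hε : 0 < ε) :
    ∃ K : ℝ, ∀ (W : WeierstrassCurve ℚ) [W.IsElliptic],
      (multiplicativeValuationProduct W : ℝ) ≤ K * (W.conductorNorm ℤ : ℝ) ^ ε := by
  obtain ⟨C₁, hC₁⟩ := hS 1 one_pos
  set C := max C₁ 1 with hCdef
  have hC1 : 1 ≤ C := le_max_right _ _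
  have hC0 : 0 < C := one_pos.trans_le hC1
  set δ := ε / 7 with hδ
  have hδ0 : 0 < δ := by positivity
  have hlog2 : 0 < Real.log 2 := Real.log_pos one_lt_two
  set B : ℝ := max 1 (δ * Real.log 2)⁻¹ with hB
  have hB1 : 1 ≤ B := le_max_left _ _
  set M : ℕ := ⌈Real.exp (1 / δ)⌉₊ with hM
  set K : ℝ := C ^ δ * B ^ (M + 1) with hK
  have hK1 : 1 ≤ K := one_le_mul_of_one_le_of_one_le (Real.one_le_rpow hC1 hδ0.le)
    (one_le_pow₀ hB1)
  refine ⟨K, fun W _ => ?_⟩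
  set N := W.conductorNorm ℤ with hN
  set Δ := W.minimalDiscriminantNorm ℤ with hΔ
  have hNpos : 0 < N := conductorNorm_pos_holds W
  have hN1 : (1 : ℝ) ≤ N := by exact_mod_cast hNpos
  have hN0 : (0 : ℝ) < N := by linarith
  have hNε : 1 ≤ (N : ℝ) ^ ε := Real.one_le_rpow hN1 hε.le
  set S := N.primeFactors.filter (fun p => ¬ p ^ 2 ∣ N) with hS
  set x : ℕ → ℕ := fun p => Δ.factorization p with hx
  have hT : (multiplicativeValuationProduct W : ℝ) = ∏ p ∈ S, ((x p : ℕ) : ℝ) := by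
    rw [multiplicativeValuationProduct_def, Nat.cast_prod]
  rw [hT]
  -- degenerate case `Δ = 0` (junk value; all `x_p = 0`)
  by_cases hΔ0 : Δ = 0
  · have : ∏ p ∈ S, ((x p : ℕ) : ℝ) ≤ 1 := by
      refine Finset.prod_le_one (fun _ _ => Nat.cast_nonneg _) fun p _ => ?_
      simp [hx, hΔ0]
    calc ∏ p ∈ S, ((x p : ℕ) : ℝ) ≤ 1 := this
      _ ≤ K * (N : ℝ) ^ ε := one_le_mul_of_one_le_of_one_le hK1 hNε
  have hSprime : ∀ p ∈ S, p.Prime := fun p hp => Nat.prime_of_mem_primeFactors (Finset.mem_filter.mp hp).1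
  -- Step 1–2: `T ≤ ∏ p^{δ x_p} · ∏ (δ log p)⁻¹`
  have hstep : ∏ p ∈ S, ((x p : ℕ) : ℝ) ≤
      (∏ p ∈ S, ((p : ℝ) ^ (x p : ℕ)) ^ δ) * ∏ p ∈ S, (δ * Real.log p)⁻¹ := by
    rw [← Finset.prod_mul_distrib]
    refine Finset.prod_le_prod (fun _ _ => Nat.cast_nonneg _) fun p hp => ?_
    have hp2 : (2 : ℝ) ≤ p := by exact_mod_cast (hSprime p hp).two_le
    have h := le_rpow_div (x := (x p : ℝ)) hp2 hδ0
    rw [div_eq_mul_inv] at h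
    have hpow : ((p : ℝ) ^ (x p : ℕ)) ^ δ = (p : ℝ) ^ (δ * (x p : ℝ)) := by
      rw [← Real.rpow_natCast, ← Real.rpow_mul (by linarith), mul_comm]
    rwa [hpow]
  -- Step 3–4: `∏ p^{x_p} ≤ Δ ≤ C N^7`
  have hD : (∏ p ∈ S, ((p : ℝ) ^ (x p : ℕ))) ≤ C * (N : ℝ) ^ (7 : ℝ) := by
    have hdvd : ∏ p ∈ S, p ^ x p ∣ Δ := by
      have hD0 : ∏ p ∈ S, p ^ x p ≠ 0 :=
        Finset.prod_ne_zero_iff.mpr fun p hp => pow_ne_zero _ (hSprime p hp).ne_zero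
      rw [← Nat.factorization_le_iff_dvd hD0 hΔ0,
        Nat.factorization_prod fun p hp => pow_ne_zero _ (hSprime p hp).ne_zero]
      intro q
      rw [Finsupp.finsetSum_apply,
        Finset.sum_congr rfl fun p hp => by rw [(hSprime p hp).factorization_pow]]
      simp only [Finsupp.single_apply]
      rw [Finset.sum_ite_eq']
      split_ifs <;> simp [hx]
    have h1 : ((∏ p ∈ S, p ^ x p : ℕ) : ℝ) ≤ Δ := by
      exact_mod_cast Nat.le_of_dvd (Nat.pos_of_ne_zero hΔ0) hdvd
    calc (∏ p ∈ S, ((p : ℝ) ^ (x p : ℕ))) = ((∏ p ∈ S, p ^ x p : ℕ) : ℝ) := by push_cast; rfl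
      _ ≤ Δ := h1
      _ ≤ C₁ * (N : ℝ) ^ ((6 : ℝ) + 1) := hC₁ W
      _ = C₁ * (N : ℝ) ^ (7 : ℝ) := by norm_num
      _ ≤ C * (N : ℝ) ^ (7 : ℝ) := mul_le_mul_of_nonneg_right (le_max_left _ _) (by positivity)
  have hDnn : 0 ≤ ∏ p ∈ S, ((p : ℝ) ^ (x p : ℕ)) :=
    Finset.prod_nonneg fun _ _ => by positivity
  -- Step 5: `∏ (δ log p)⁻¹ ≤ B^{M+1}`
  have hlogfac : ∏ p ∈ S, (δ * Real.log p)⁻¹ ≤ B ^ (M + 1) := by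
    rw [← Finset.prod_filter_mul_prod_filter_not S (fun p => p ≤ M)]
    have hsmall : ∏ p ∈ S.filter (fun p => p ≤ M), (δ * Real.log p)⁻¹ ≤ B ^ (M + 1) := by
      have hcard : (S.filter (fun p => p ≤ M)).card ≤ M + 1 := by
        calc (S.filter (fun p => p ≤ M)).card ≤ (Finset.range (M + 1)).card :=
              Finset.card_le_card fun p hp => by
                rw [Finset.mem_range]; exact Nat.lt_succ_of_le (Finset.mem_filter.mp hp).2
          _ = M + 1 := Finset.card_range _
      calc ∏ p ∈ S.filter (fun p => p ≤ M), (δ * Real.log p)⁻¹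
          ≤ ∏ _p ∈ S.filter (fun p => p ≤ M), B := by
            refine Finset.prod_le_prod (fun p hp => ?_) (fun p hp => ?_)
            · have := (hSprime p (Finset.mem_filter.mp hp).1).two_le
              have : (2 : ℝ) ≤ p := by exact_mod_cast this
              have : 0 < Real.log p := Real.log_pos (by linarith)
              positivity
            · have h2 := (hSprime p (Finset.mem_filter.mp hp).1).two_le
              have h2' : (2 : ℝ) ≤ p := by exact_mod_cast h2
              have hlp : Real.log 2 ≤ Real.log p := Real.log_le_log two_pos h2'
              calc (δ * Real.log p)⁻¹ ≤ (δ * Real.log 2)⁻¹ := by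
                    apply inv_anti₀ (mul_pos hδ0 hlog2)
                    exact mul_le_mul_of_nonneg_left hlp hδ0.le
                _ ≤ B := le_max_right _ _
        _ = B ^ (S.filter (fun p => p ≤ M)).card := Finset.prod_const _
        _ ≤ B ^ (M + 1) := pow_le_pow_right₀ hB1 hcard
    have hlarge : ∏ p ∈ S.filter (fun p => ¬ p ≤ M), (δ * Real.log p)⁻¹ ≤ 1 := by
      refine Finset.prod_le_one (fun p hp => ?_) (fun p hp => ?_)
      · have := (hSprime p (Finset.mem_filter.mp hp).1).two_le
        have : (2 : ℝ) ≤ p := by exact_mod_cast this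
        have : 0 < Real.log p := Real.log_pos (by linarith)
        positivity
      · have hpM : M < p := not_le.mp (Finset.mem_filter.mp hp).2
        have hp0 : (0 : ℝ) < p := by exact_mod_cast lt_of_le_of_lt (Nat.zero_le _) hpM
        have hexp : Real.exp (1 / δ) < p := by
          calc Real.exp (1 / δ) ≤ M := Nat.le_ceil _
            _ < p := by exact_mod_cast hpM
        have hlog : 1 / δ < Real.log p := (Real.lt_log_iff_exp_lt hp0).mpr hexp
        have h1 : 1 ≤ δ * Real.log p := by
          rw [div_lt_iff₀ hδ0] at hlog; linarith
        exact inv_le_one_of_one_le₀ h1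
    have hsmall0 : 0 ≤ ∏ p ∈ S.filter (fun p => p ≤ M), (δ * Real.log p)⁻¹ :=
      Finset.prod_nonneg fun p hp => by
        have := (hSprime p (Finset.mem_filter.mp hp).1).two_le
        have : (2 : ℝ) ≤ p := by exact_mod_cast this
        have : 0 < Real.log p := Real.log_pos (by linarith)
        positivity
    calc _ ≤ B ^ (M + 1) * 1 := mul_le_mul hsmall hlarge
          (Finset.prod_nonneg fun p hp => by
            have := (hSprime p (Finset.mem_filter.mp hp).1).two_le
            have : (2 : ℝ) ≤ p := by exact_mod_cast this
            have : 0 < Real.log p := Real.log_pos (by linarith)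
            positivity) (by positivity)
      _ = B ^ (M + 1) := mul_one _
  -- Step 6: assemble
  calc ∏ p ∈ S, ((x p : ℕ) : ℝ)
      ≤ (∏ p ∈ S, ((p : ℝ) ^ (x p : ℕ)) ^ δ) * ∏ p ∈ S, (δ * Real.log p)⁻¹ := hstep
    _ = (∏ p ∈ S, ((p : ℝ) ^ (x p : ℕ))) ^ δ * ∏ p ∈ S, (δ * Real.log p)⁻¹ := by
        rw [Real.finsetProd_rpow _ _ (fun _ _ => by positivity)]
    _ ≤ (C * (N : ℝ) ^ (7 : ℝ)) ^ δ * B ^ (M + 1) := by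
        refine mul_le_mul (Real.rpow_le_rpow hDnn hD hδ0.le) hlogfac
          (Finset.prod_nonneg fun p hp => ?_) (by positivity)
        have := (hSprime p hp).two_le
        have : (2 : ℝ) ≤ p := by exact_mod_cast this
        have : 0 < Real.log p := Real.log_pos (by linarith)
        positivity
    _ = K * (N : ℝ) ^ ε := by
        rw [Real.mul_rpow hC0.le (by positivity), ← Real.rpow_mul hN0.le, hK, hδ]
        ring_nf

end Literature.NumberTheory.EllipticCurves
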